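import Summits.RiemannHypothesis.RiemannHypothesis.Theorems.EtaLeadingQuarterSecondMomentAFEBounds
import HarnessLib

/-!
# Sharp-ended eta vector at the zeros, V: the refined approximate functional equation away from
# and at the transition points (route EtaLeadingQuarter, item `EtaLeadingSecondMoment`,
# stmt-RiemannHypothesis-21791)

Specialisations of part IV (`norm_zeta_sub_refined`), `s = 1/2 + it`, `t ≥ 1`, `y = t/(2πX)`,
`n = [y]`, `Q(X, t) = ζ(s) − ∑_{m ≤ X} m^{-s} + X^{1-s}/(1-s) − afeCoeff(s) ∑_{ν ≤ n} ν^{s-1}`: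

* `norm_zeta_sub_refined_dist` (`Δ₀ = Δ₁ = 0`, `X ≥ 1`, `{y} ≠ 0` if `n ≥ 1`):
  `‖Q‖ ≤ 9X^{-1/2}(1 + log(y+2)) + [n ≥ 1](2/π)X^{-1/2}/{y} + (4/π)X^{-1/2}/(1 − {y})`;
* `norm_zeta_sub_refined_transition` (`Δ_ν = √(X/ν)`, `X ≥ 4`):
  `‖Q‖ ≤ 9X^{-1/2}(1 + log(y+2)) + 7/√y`;
* `norm_zeta_sub_refined_eta` — the form consumed by the second moment over the zeros: for
  `0 < η ≤ 1/2`, `‖Q‖ ≤ (9(1 + log(y+2)) + 2/η) X^{-1/2} + [y is η-close to an integer ≥ 1]·7/√y`.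

RH-free real analysis. Nothing here bears on the truth of RH.
-/

noncomputable section

open Complex MeasureTheory Set Filter intervalIntegral Finset
open scoped Real Topology Interval

set_option linter.dupNamespace false  -- the mandated namespace repeats `RiemannHypothesis`

namespace Summit.RiemannHypothesis.RiemannHypothesis.Theorems.EtaLeadingQuarter.SecondMomentAFE

open Literature.NumberTheory.LFunctions Literature.NumberTheory.LFunctions.AFE

/-- **Away from the transition points.** For `s = 1/2 + it`, `t ≥ 1`, `X ≥ 1`, `y = t/(2πX)`,
`n = [y]` with `{y} ≠ 0` when `n ≥ 1`:
`‖Q(X,t)‖ ≤ 9X^{-1/2}(1 + log(y+2)) + [n ≥ 1](2/π)X^{-1/2}/{y} + (4/π)X^{-1/2}/(1 − {y})`.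
[folklore] -/
theorem norm_zeta_sub_refined_dist {t : ℝ} {X : ℕ} (ht1 : 1 ≤ t) (hX1 : 1 ≤ X)
    (hd : 1 ≤ ⌊t / (2 * π * X)⌋₊ → 0 < Int.fract (t / (2 * π * X)))
    (s : ℂ) (hs : s = 1 / 2 + t * I) :
    ‖riemannZeta s - ∑ n ∈ Finset.Icc 1 X, (n : ℂ) ^ (-s) + (X : ℂ) ^ (1 - s) / (1 - s)
        - afeCoeff s * ∑ n ∈ Finset.Icc 1 ⌊t / (2 * π * X)⌋₊, (n : ℂ) ^ (s - 1)‖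
      ≤ 9 * (X : ℝ) ^ (-(1 / 2 : ℝ)) * (1 + Real.log (t / (2 * π * X) + 2))
        + (if 1 ≤ ⌊t / (2 * π * X)⌋₊ then
            2 / π * (X : ℝ) ^ (-(1 / 2 : ℝ)) / Int.fract (t / (2 * π * X)) else 0)
        + 4 / π * (X : ℝ) ^ (-(1 / 2 : ℝ)) / (1 - Int.fract (t / (2 * π * X))) := by
  have hX0 : (0 : ℝ) < X := by exact_mod_cast (show 0 < X by omega)
  have hΔ0pos : 1 ≤ ⌊t / (2 * π * X)⌋₊ →
      0 < X * Int.fract (t / (2 * π * X)) + ⌊t / (2 * π * X)⌋₊ * (0 : ℝ) := by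
    intro h; rw [mul_zero, add_zero]; exact mul_pos hX0 (hd h)
  have h := norm_zeta_sub_refined ht1 hX1 le_rfl (by positivity) hΔ0pos le_rfl s hs
  refine h.trans (le_of_eq ?_)
  have hfr1 : Int.fract (t / (2 * π * X)) < 1 := Int.fract_lt_one _
  have e1 : (X : ℝ) ^ (1 / 2 : ℝ) = X * (X : ℝ) ^ (-(1 / 2 : ℝ)) := by
    rw [show (-(1 / 2 : ℝ)) = (1 / 2 : ℝ) - 1 by norm_num, Real.rpow_sub_one hX0.ne']
    field_simp
  simp only [zero_mul, mul_zero, add_zero, zero_add, e1]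
  split_ifs with h1
  · have hf0 : 0 < Int.fract (t / (2 * π * X)) := hd h1
    field_simp
  · field_simp

/-- **At the transition points.** For `s = 1/2 + it`, `t ≥ 1`, `X ≥ 4`, `y = t/(2πX)`:
`‖Q(X,t)‖ ≤ 9X^{-1/2}(1 + log(y+2)) + 7/√y` (part IV with the boundary layers
`Δ₀ = √(X/n)`, `Δ₁ = √(X/(n+1))`, `n = [y]`: the two adjacent frequencies then cost
`(√2 + 2/π)/√n + (2 + 4/π)/√(n+1) ≤ 7/√y`). [folklore] -/
theorem norm_zeta_sub_refined_transition {t : ℝ} {X : ℕ} (ht1 : 1 ≤ t) (hX4 : 4 ≤ X)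
    (s : ℂ) (hs : s = 1 / 2 + t * I) :
    ‖riemannZeta s - ∑ n ∈ Finset.Icc 1 X, (n : ℂ) ^ (-s) + (X : ℂ) ^ (1 - s) / (1 - s)
        - afeCoeff s * ∑ n ∈ Finset.Icc 1 ⌊t / (2 * π * X)⌋₊, (n : ℂ) ^ (s - 1)‖
      ≤ 9 * (X : ℝ) ^ (-(1 / 2 : ℝ)) * (1 + Real.log (t / (2 * π * X) + 2))
        + 7 / Real.sqrt (t / (2 * π * X)) := by
  have hπ := Real.pi_pos
  have hπ3 := Real.pi_gt_three
  have hX1 : 1 ≤ X := by omega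
  have hXR : (4 : ℝ) ≤ X := by exact_mod_cast hX4
  have hX0 : (0 : ℝ) < X := by linarith
  set r : ℝ := Real.sqrt X with hr
  have hr0 : 0 < r := Real.sqrt_pos.2 hX0
  have hr2 : 2 ≤ r := by
    have h4 : Real.sqrt 4 = 2 := by
      rw [show (4 : ℝ) = 2 ^ 2 by norm_num, Real.sqrt_sq (by norm_num)]
    rw [hr, ← h4]
    exact Real.sqrt_le_sqrt hXR
  have hrr : r * r = X := Real.mul_self_sqrt hX0.le
  -- the boundary layers
  set n : ℕ := ⌊t / (2 * π * X)⌋₊ with hn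
  set Δ₀ : ℝ := r / Real.sqrt n with hΔ₀
  set Δ₁ : ℝ := r / Real.sqrt (n + 1) with hΔ₁
  have hn0R : (0 : ℝ) ≤ n := Nat.cast_nonneg n
  have hΔ0 : 0 ≤ Δ₀ := by positivity
  have hΔ1 : 0 ≤ Δ₁ := by positivity
  have hΔ0a : Δ₀ ≤ X / 2 := by
    rcases Nat.eq_zero_or_pos n with h0 | hpos
    · rw [hΔ₀, h0, Nat.cast_zero, Real.sqrt_zero, div_zero]; positivity
    · have hn1 : (1 : ℝ) ≤ Real.sqrt n := by
        rw [show (1 : ℝ) = Real.sqrt 1 by simp]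
        exact Real.sqrt_le_sqrt (by exact_mod_cast hpos)
      calc Δ₀ ≤ r := div_le_self hr0.le hn1
        _ ≤ X / 2 := by nlinarith only [hrr, hr2, hr0]
  have hΔ0pos : 1 ≤ n → 0 < X * Int.fract (t / (2 * π * X)) + n * Δ₀ := by
    intro h1
    have hsn : 0 < Real.sqrt n := Real.sqrt_pos.2 (by exact_mod_cast h1)
    have : 0 < (n : ℝ) * Δ₀ := mul_pos (by exact_mod_cast h1) (div_pos hr0 hsn)
    have : 0 ≤ (X : ℝ) * Int.fract (t / (2 * π * X)) := mul_nonneg hX0.le (Int.fract_nonneg _)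
    linarith
  have h := norm_zeta_sub_refined ht1 hX1 hΔ0 hΔ0a hΔ0pos hΔ1 s hs
  refine h.trans ?_
  rw [add_assoc, add_le_add_iff_left]
  -- abbreviate
  set y : ℝ := t / (2 * π * X) with hydef
  set f : ℝ := Int.fract y with hf
  have hy0 : 0 < y := by rw [hydef]; positivity
  have hfl : (n : ℝ) ≤ y := Nat.floor_le hy0.le
  have hfl' : y < n + 1 := Nat.lt_floor_add_one y
  have hf0 : 0 ≤ f := Int.fract_nonneg y
  have hf1 : f < 1 := Int.fract_lt_one y
  have hsy : 0 < Real.sqrt y := Real.sqrt_pos.2 hy0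
  -- rpow ↔ sqrt
  have e_half : (X : ℝ) ^ (1 / 2 : ℝ) = r := by rw [hr, Real.sqrt_eq_rpow]
  have e_neg : (X : ℝ) ^ (-(1 / 2 : ℝ)) = r⁻¹ := by
    rw [Real.rpow_neg hX0.le, ← Real.sqrt_eq_rpow]
  have e_neg2 : ((X : ℝ) / 2) ^ (-(1 / 2 : ℝ)) = Real.sqrt 2 / r := by
    rw [Real.rpow_neg (by positivity), ← Real.sqrt_eq_rpow, Real.sqrt_div' _ (by norm_num),
      inv_div]
  rw [e_half, e_neg, e_neg2]
  have hs2 : Real.sqrt 2 < 1.415 := by rw [Real.sqrt_lt' (by norm_num)]; norm_num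
  have hs2' : 0 < Real.sqrt 2 := Real.sqrt_pos.2 (by norm_num)
  -- the frequency above `y`
  have hsn1 : 0 < Real.sqrt (n + 1) := Real.sqrt_pos.2 (by linarith)
  have hsn1sq : Real.sqrt (n + 1) * Real.sqrt (n + 1) = n + 1 := Real.mul_self_sqrt (by linarith)
  have hT1 : 2 * Δ₁ * r⁻¹ + 4 / π * r / (X * (1 - f) + (n + 1) * Δ₁)
      ≤ (2 + 4 / π) / Real.sqrt (n + 1) := by
    have e1 : 2 * Δ₁ * r⁻¹ = 2 / Real.sqrt (n + 1) := by
      rw [hΔ₁]; field_simp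
    have hden : (n + 1) * Δ₁ ≤ X * (1 - f) + (n + 1) * Δ₁ := by
      have : 0 ≤ (X : ℝ) * (1 - f) := mul_nonneg hX0.le (by linarith); linarith
    have hden0 : 0 < (n + 1) * Δ₁ := by positivity
    have e2 : 4 / π * r / (X * (1 - f) + (n + 1) * Δ₁) ≤ 4 / π * r / ((n + 1) * Δ₁) :=
      div_le_div_of_nonneg_left (by positivity) hden0 hden
    have hq : ((n : ℝ) + 1) * Δ₁ = r * Real.sqrt (n + 1) := by
      rw [hΔ₁, mul_comm, div_mul_eq_mul_div, mul_div_assoc, Real.div_sqrt]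
    have e3 : 4 / π * r / ((n + 1) * Δ₁) = 4 / π / Real.sqrt (n + 1) := by
      rw [hq, div_eq_div_iff (by positivity) (by positivity)]
      ring
    rw [e1, add_div]
    linarith [e2, e3.le]
  -- the frequency below `y`
  have hT0 : (if 1 ≤ n then Δ₀ * (Real.sqrt 2 / r) + 2 / π * r / (X * f + n * Δ₀) else 0)
      ≤ (if 1 ≤ n then (Real.sqrt 2 + 2 / π) / Real.sqrt n else 0) := by
    split_ifs with h1
    · have hnpos : (0 : ℝ) < n := by exact_mod_cast h1
      have hsn : 0 < Real.sqrt n := Real.sqrt_pos.2 hnpos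
      have hsnsq : Real.sqrt n * Real.sqrt n = n := Real.mul_self_sqrt hnpos.le
      have e1 : Δ₀ * (Real.sqrt 2 / r) = Real.sqrt 2 / Real.sqrt n := by
        rw [hΔ₀]; field_simp
      have hden : n * Δ₀ ≤ X * f + n * Δ₀ := by
        have : 0 ≤ (X : ℝ) * f := mul_nonneg hX0.le hf0; linarith
      have hden0 : 0 < n * Δ₀ := by positivity
      have e2 : 2 / π * r / (X * f + n * Δ₀) ≤ 2 / π * r / (n * Δ₀) :=
        div_le_div_of_nonneg_left (by positivity) hden0 hden
      have hq : (n : ℝ) * Δ₀ = r * Real.sqrt n := by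
        rw [hΔ₀, mul_comm, div_mul_eq_mul_div, mul_div_assoc, Real.div_sqrt]
      have e3 : 2 / π * r / (n * Δ₀) = 2 / π / Real.sqrt n := by
        rw [hq, div_eq_div_iff (by positivity) (by positivity)]
        ring
      rw [e1, add_div]
      linarith [e2, e3.le]
    · exact le_rfl
  -- compare `1/√n`, `1/√(n+1)` with `1/√y`
  have hB1 : (2 + 4 / π) / Real.sqrt (n + 1) ≤ (2 + 4 / π) / Real.sqrt y := by
    apply div_le_div_of_nonneg_left (by positivity) hsy
    exact Real.sqrt_le_sqrt hfl'.le
  have hB0 : (if 1 ≤ n then (Real.sqrt 2 + 2 / π) / Real.sqrt n else 0)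
      ≤ (Real.sqrt 2 + 2 / π) * Real.sqrt 2 / Real.sqrt y := by
    split_ifs with h1
    · have hnpos : (0 : ℝ) < n := by exact_mod_cast h1
      have hsn : 0 < Real.sqrt n := Real.sqrt_pos.2 hnpos
      have hn1R : (1 : ℝ) ≤ n := by exact_mod_cast h1
      -- `√y ≤ √2 √n`
      have hy2n : Real.sqrt y ≤ Real.sqrt 2 * Real.sqrt n := by
        rw [← Real.sqrt_mul (by norm_num)]
        exact Real.sqrt_le_sqrt (by linarith)
      rw [div_le_div_iff₀ hsn hsy]
      calc (Real.sqrt 2 + 2 / π) * Real.sqrt y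
          ≤ (Real.sqrt 2 + 2 / π) * (Real.sqrt 2 * Real.sqrt n) :=
            mul_le_mul_of_nonneg_left hy2n (by positivity)
        _ = (Real.sqrt 2 + 2 / π) * Real.sqrt 2 * Real.sqrt n := by ring
    · positivity
  -- constants: `(√2 + 2/π)√2 + 2 + 4/π ≤ 7`
  have hconst : (Real.sqrt 2 + 2 / π) * Real.sqrt 2 + (2 + 4 / π) ≤ 7 := by
    have hsq : Real.sqrt 2 * Real.sqrt 2 = 2 := Real.mul_self_sqrt (by norm_num)
    have h2π : 2 / π ≤ 2 / 3 := div_le_div_of_nonneg_left (by norm_num) (by norm_num) hπ3.le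
    have h4π : 4 / π ≤ 4 / 3 := div_le_div_of_nonneg_left (by norm_num) (by norm_num) hπ3.le
    nlinarith only [hsq, h2π, h4π, hs2, hs2']
  have hfin : (Real.sqrt 2 + 2 / π) * Real.sqrt 2 / Real.sqrt y + (2 + 4 / π) / Real.sqrt y
      ≤ 7 / Real.sqrt y := by
    rw [← add_div]
    exact div_le_div_of_nonneg_right hconst hsy.le
  linarith [hT0, hT1, hB0, hB1, hfin]

/-- **The form consumed by the second moment over the zeros.** For `s = 1/2 + it`, `t ≥ 1`,
`X ≥ 4`, `y = t/(2πX)`, `n = [y]` and any `0 < η ≤ 1/2`: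
`‖Q(X,t)‖ ≤ (9(1 + log(y+2)) + 2/η) X^{-1/2} + [({y} < η ∧ n ≥ 1) ∨ 1 − {y} < η]·7/√y`:
away from the integers `≥ 1` the two adjacent frequencies cost `≤ (6/π)X^{-1/2}/η`, and within
`η` of them `≤ 7/√y`. [folklore] -/
theorem norm_zeta_sub_refined_eta {t η : ℝ} {X : ℕ} (ht1 : 1 ≤ t) (hX4 : 4 ≤ X) (hη0 : 0 < η)
    (hη1 : η ≤ 1 / 2) (s : ℂ) (hs : s = 1 / 2 + t * I) :
    ‖riemannZeta s - ∑ n ∈ Finset.Icc 1 X, (n : ℂ) ^ (-s) + (X : ℂ) ^ (1 - s) / (1 - s)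
        - afeCoeff s * ∑ n ∈ Finset.Icc 1 ⌊t / (2 * π * X)⌋₊, (n : ℂ) ^ (s - 1)‖
      ≤ (9 * (1 + Real.log (t / (2 * π * X) + 2)) + 2 / η) * (X : ℝ) ^ (-(1 / 2 : ℝ))
        + (if (1 ≤ ⌊t / (2 * π * X)⌋₊ ∧ Int.fract (t / (2 * π * X)) < η)
              ∨ 1 - Int.fract (t / (2 * π * X)) < η
            then 7 / Real.sqrt (t / (2 * π * X)) else 0) := by
  have hπ := Real.pi_pos
  have hπ3 := Real.pi_gt_three
  have hX1 : 1 ≤ X := by omega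
  have hX0 : (0 : ℝ) < X := by exact_mod_cast (show 0 < X by omega)
  have hA0 : 0 < (X : ℝ) ^ (-(1 / 2 : ℝ)) := Real.rpow_pos_of_pos hX0 _
  have hy0 : 0 < t / (2 * π * X) := by positivity
  have hL0 : 0 ≤ 1 + Real.log (t / (2 * π * X) + 2) := by
    have : 0 ≤ Real.log (t / (2 * π * X) + 2) := Real.log_nonneg (by linarith); linarith
  split_ifs with hnear
  · have h := norm_zeta_sub_refined_transition ht1 hX4 s hs
    refine h.trans ?_
    have : 0 ≤ 2 / η * (X : ℝ) ^ (-(1 / 2 : ℝ)) := by positivity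
    nlinarith [this]
  · push Not at hnear
    have hfr1 : Int.fract (t / (2 * π * X)) < 1 := Int.fract_lt_one _
    have hfar1 : η ≤ 1 - Int.fract (t / (2 * π * X)) := hnear.2
    have hd : 1 ≤ ⌊t / (2 * π * X)⌋₊ → 0 < Int.fract (t / (2 * π * X)) := by
      intro h1
      have : η ≤ Int.fract (t / (2 * π * X)) := hnear.1 h1
      linarith
    have h := norm_zeta_sub_refined_dist ht1 hX1 hd s hs
    refine h.trans ?_
    rw [add_zero]
    have hB : 4 / π * (X : ℝ) ^ (-(1 / 2 : ℝ)) / (1 - Int.fract (t / (2 * π * X)))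
        ≤ 4 / 3 * (X : ℝ) ^ (-(1 / 2 : ℝ)) / η := by
      calc 4 / π * (X : ℝ) ^ (-(1 / 2 : ℝ)) / (1 - Int.fract (t / (2 * π * X)))
          ≤ 4 / π * (X : ℝ) ^ (-(1 / 2 : ℝ)) / η :=
            div_le_div_of_nonneg_left (by positivity) hη0 hfar1
        _ ≤ 4 / 3 * (X : ℝ) ^ (-(1 / 2 : ℝ)) / η := by
            apply div_le_div_of_nonneg_right _ hη0.le
            apply mul_le_mul_of_nonneg_right _ hA0.le
            exact div_le_div_of_nonneg_left (by norm_num) (by norm_num) hπ3.le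
    have hA : (if 1 ≤ ⌊t / (2 * π * X)⌋₊ then
          2 / π * (X : ℝ) ^ (-(1 / 2 : ℝ)) / Int.fract (t / (2 * π * X)) else 0)
        ≤ 2 / 3 * (X : ℝ) ^ (-(1 / 2 : ℝ)) / η := by
      split_ifs with h1
      · have hfar0 : η ≤ Int.fract (t / (2 * π * X)) := hnear.1 h1
        calc 2 / π * (X : ℝ) ^ (-(1 / 2 : ℝ)) / Int.fract (t / (2 * π * X))
            ≤ 2 / π * (X : ℝ) ^ (-(1 / 2 : ℝ)) / η :=
              div_le_div_of_nonneg_left (by positivity) hη0 hfar0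
          _ ≤ 2 / 3 * (X : ℝ) ^ (-(1 / 2 : ℝ)) / η := by
              apply div_le_div_of_nonneg_right _ hη0.le
              apply mul_le_mul_of_nonneg_right _ hA0.le
              exact div_le_div_of_nonneg_left (by norm_num) (by norm_num) hπ3.le
      · positivity
    have e : (9 * (1 + Real.log (t / (2 * π * X) + 2)) + 2 / η) * (X : ℝ) ^ (-(1 / 2 : ℝ))
        = 9 * (X : ℝ) ^ (-(1 / 2 : ℝ)) * (1 + Real.log (t / (2 * π * X) + 2))
          + 2 / 3 * (X : ℝ) ^ (-(1 / 2 : ℝ)) / η + 4 / 3 * (X : ℝ) ^ (-(1 / 2 : ℝ)) / η := by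
      field_simp; ring
    rw [e]
    linarith [hA, hB]

end Summit.RiemannHypothesis.RiemannHypothesis.Theorems.EtaLeadingQuarter.SecondMomentAFE

end
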